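import Literature.Probability.Process.ItoIntegralScaling
import HarnessLib

/-!
# Finite linear combinations IN THE INTEGRAND of the Itô characterisation: `∫ (Σᵢ cᵢ Hᵢ) dB = Σᵢ cᵢ ∫ Hᵢ dB`

Topic `Probability/Process`; theorems only.  Companion of `ItoIntegralLinearity` (`IsItoIntegral.add`,
`IsItoIntegral.sub`), `ItoIntegralScaling` (`IsItoIntegral.const_mul_left`) and `ItoIntegralIntegratorLinearity`
(`IsItoIntegral.sum_right_of_martingale`, linearity in the INTEGRATOR) for the tree's characterised Itô integral
`IsItoIntegral H B J 𝓕 P`: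

* `IsItoIntegral.sum_left_of_martingale` — for a nonempty finite family of martingale Itô integrals
  `Jᵢ = ∫ Hᵢ dB` (integrands with Borel paths) and real constants `cᵢ`, the combination `Σᵢ cᵢ Jᵢ` is the Itô
  integral of `Σᵢ cᵢ Hᵢ` against `B`, and is again a martingale.

Nonemptiness is required because the characterisation records an approximating sequence of the integrand, which an
empty family does not supply.  This is Revuz–Yor, Ch. IV Prop. (2.10)(i) (linearity of `K ↦ K·M`) in the characterised
form; it is the input for transporting the Itô integral equations of an SDE under a constant linear change of
coordinates (seat `ym-line-csu-p1` g11: gauge covariance in law of the SU(2) lattice Langevin dynamics, where the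
matrix coordinates are conjugated by constant unitaries).

## References
* D. Revuz, M. Yor, *Continuous Martingales and Brownian Motion* (3rd ed., 1999), Ch. IV, Prop. (2.10)(i).
-/

open MeasureTheory ProbabilityTheory Filter Finset
open scoped NNReal ENNReal Topology

noncomputable section

namespace Literature.Probability.Process

variable {Ω : Type*} {m : MeasurableSpace Ω} {B : ℝ≥0 → Ω → ℝ} {𝓕 : Filtration ℝ≥0 m} {P : Measure Ω}

/-- ★ **`∫ (Σᵢ cᵢ Hᵢ) dB = Σᵢ cᵢ ∫ Hᵢ dB` in the Itô characterisation** (nonempty finite family of MARTINGALE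
integrals, integrands with Borel paths): the combination `Σᵢ cᵢ Jᵢ` is the Itô integral of `Σᵢ cᵢ Hᵢ` and is a
martingale.  Induction on the family with `IsItoIntegral.const_mul_left_of_martingale` and
`IsItoIntegral.add_of_martingale`. [cite: RevuzYor1999, Ch. IV Prop. (2.10)(i)] -/
theorem IsItoIntegral.sum_left_of_martingale {ι : Type*} {s : Finset ι} (hs : s.Nonempty) (c : ι → ℝ)
    {Hf Jf : ι → ℝ≥0 → Ω → ℝ}
    (hJ : ∀ i ∈ s, IsItoIntegral (Hf i) B (Jf i) 𝓕 P) (hM : ∀ i ∈ s, Martingale (Jf i) 𝓕 P)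
    (hH : ∀ i ∈ s, ∀ ω, Measurable fun r : ℝ ↦ Hf i r.toNNReal ω) :
    IsItoIntegral (fun t ω ↦ ∑ i ∈ s, c i * Hf i t ω) B (fun t ω ↦ ∑ i ∈ s, c i * Jf i t ω) 𝓕 P ∧
      Martingale (fun t ω ↦ ∑ i ∈ s, c i * Jf i t ω) 𝓕 P := by
  classical
  induction s using Finset.induction_on with
  | empty => exact absurd hs Finset.not_nonempty_empty
  | insert a s ha ih =>
    -- the new summand
    have hJa := hJ a (Finset.mem_insert_self a s)
    have hMa := hM a (Finset.mem_insert_self a s)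
    have hHa := hH a (Finset.mem_insert_self a s)
    have h1 : IsItoIntegral (fun t ω ↦ c a * Hf a t ω) B (fun t ω ↦ c a * Jf a t ω) 𝓕 P :=
      hJa.const_mul_left_of_martingale (c a) hHa hMa
    have hM1 : Martingale (fun t ω ↦ c a * Jf a t ω) 𝓕 P := by
      have := hMa.smul (c a)
      simpa only [Pi.smul_def, smul_eq_mul] using this
    have hB1 : ∀ ω, Measurable fun r : ℝ ↦ c a * Hf a r.toNNReal ω := fun ω ↦ (hHa ω).const_mul _
    rcases s.eq_empty_or_nonempty with rfl | hne
    · simp only [Finset.sum_insert ha, Finset.sum_empty, add_zero]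
      exact ⟨h1, hM1⟩
    · have ih' := ih hne (fun i hi ↦ hJ i (Finset.mem_insert_of_mem hi))
        (fun i hi ↦ hM i (Finset.mem_insert_of_mem hi)) (fun i hi ↦ hH i (Finset.mem_insert_of_mem hi))
      have hBs : ∀ ω, Measurable fun r : ℝ ↦ ∑ i ∈ s, c i * Hf i r.toNNReal ω := fun ω ↦
        Finset.measurable_sum s fun i hi ↦ (hH i (Finset.mem_insert_of_mem hi) ω).const_mul _
      have h2 := h1.add_of_martingale ih'.1 hB1 hBs hM1 ih'.2
      have hM2 := hM1.add ih'.2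
      simp only [Finset.sum_insert ha]
      exact ⟨h2, hM2⟩

/-- The same over a nonempty finite index TYPE (`s = univ`). [cite: RevuzYor1999, Ch. IV Prop. (2.10)(i)] -/
theorem IsItoIntegral.sum_univ_left_of_martingale {ι : Type*} [Fintype ι] [Nonempty ι] (c : ι → ℝ)
    {Hf Jf : ι → ℝ≥0 → Ω → ℝ}
    (hJ : ∀ i, IsItoIntegral (Hf i) B (Jf i) 𝓕 P) (hM : ∀ i, Martingale (Jf i) 𝓕 P)
    (hH : ∀ i ω, Measurable fun r : ℝ ↦ Hf i r.toNNReal ω) :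
    IsItoIntegral (fun t ω ↦ ∑ i, c i * Hf i t ω) B (fun t ω ↦ ∑ i, c i * Jf i t ω) 𝓕 P ∧
      Martingale (fun t ω ↦ ∑ i, c i * Jf i t ω) 𝓕 P :=
  IsItoIntegral.sum_left_of_martingale Finset.univ_nonempty c (fun i _ ↦ hJ i) (fun i _ ↦ hM i)
    (fun i _ ↦ hH i)

end Literature.Probability.Process

end
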